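import Summits.BirchSwinnertonDyer.Rank1Residual.GaloisImage.KatoKuriharaValueOfComparison
import HarnessLib

/-!
# Route `KimAtThreeKolyvagin` (W2): the evaluation glue on the TWISTED lattice `P·L_int` — PK-3's identity
# and a comparison modulo `P·p^K ℤ_p[(ℤ/n)ˣ]` give `hval` on `(1 ⊗ P)·L_int` (value side of the Kato–Kurihara
# port on the good ANOMALOUS rows at `3`, file 3)

Cell `bsd-addord`, seat `bsd-addord-w2-c4` (gen 9; owner of crux 19599 `ShallowEqDeepOffKatoStratum`, item
19077 `ShallowEqDeepAtTorsionFree`).  `--supports` 19599.  HONEST FRAMING: TOOL THEOREMS ONLY (no definition,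
no named fact, no instance, no `sorry`); pure group-ring / tensor algebra; nothing about any curve is asserted;
nothing is booked; 19599 / 19077 / 19560 stay OPEN; BSD is not proved by any of this.  Credit: n1011-p02's
evaluation dictionary (files E-A / E-B / E-C: `GroupRingEval.sum_coeff_mul_tmul_sigma`,
`sum_coeff_mul_prod_deriv_tmul_sigma`, `exists_mem_cycIntLattice_sub_eq_pow_smul_of_mapRingHom_eq`,
`sum_tmul_sigma_zeta_smul_sum_single`, `one_tmul_fieldDeriv_eq_tensorDeriv`, …) used BY NAME; this file is
E-C's ★★ MAIN GLUE (comparison form) re-run with an integral FACTOR `P` carried through.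

## What, and why

At a good ANOMALOUS `p` the semi-local dual-exponential lattice of the tame level field is the Euler-factor
lattice `(1 ⊗ P)·L_int`, `P = p − a_pδ_{[p]⁻¹} + 𝟙δ_{[p]⁻²}` (the seat's lattice lemma, module docstring of
`KimAtThreeShallowEqDeepAnomalousCongruence`), and the seat's FACTORED congruence delivers the comparison
`X⁺·∏D = (Θ·(P·V′)·∏D)^{ℚ_p} + p^K·(P·W)^{ℚ_p}`.  This file reads it through the evaluation `ev_p`:
* §1 `exists_eq_add_pow_smul_of_mapRingHom_eq` — congruent elements of `ℤ_p[(ℤ/n)ˣ]` differ by `p^K • Z`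
  (the integral form of E-B's `exists_mem_cycIntLattice_sub_eq_pow_smul_of_mapRingHom_eq`);
  `sum_coeff_coe_mul_tmul_sigma` — `ev_p(P·Z) = Σ_g P_g • (1 ⊗ σ_g)(ev_p Z)` for integral `P, Z`;
  `smul_sum_coeff_smul_tensorSigma` — that operator is `ℤ_p`-linear.
* §2 ★★ `exists_mem_cycIntLattice_one_tmul_deriv_sub_tmul_eq_pow_smul_twist_of_comparison` — from the twisted
  comparison, PK-3's identity `Θ̄·∏D = c·∏Nrm` and `∏Nrm = Σ_g δ_g`:
  `∃ l ∈ L_int, 1 ⊗ 𝔇^{field}(ev X) − ((c̃ · aug V′ · aug P)·μ(n)) ⊗ 1 = p^K • Σ_g P_g • (1 ⊗ σ_g) l` —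
  the `hval` premise shape ON THE TWISTED LATTICE (the scalar picks up `aug P = p + 𝟙 − a_p`, which the
  anomalous rider's functional `exp*_ω/E_p(1)` divides out again).
* §3 ★★ `…_symm_…_twist_of_comparison` — the symmetrised-avatar form `X⁺ = (p·λ)•(1+δ₋₁)X` with `λ` a
  `p`-adic unit (PK-4b-C's `λ = n`): `(p : ℤ_p) • (1 ⊗ 𝔇^{field}(x + σ₋₁x)) − (u⁻¹·c̃·μ(n)·aug V′·aug P) ⊗ 1
  = p^K • Σ_g P_g • (1 ⊗ σ_g) l` — the factor `p` of the avatar scalar is KEPT (it is the rider's `p • Λ`).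
HONEST LIMITS: pure algebra; closes nothing; books nothing; 0 defs / 0 facts.

References: C.-H. Kim, AJM 148 (2026) = arXiv:2203.12159, the proof of Thm. 3.13 (arXiv v3 pp. 26–28)
[Kim2022StructureSelmer]; C.-H. Kim, K. Nakamura, JNT 210 (2020) Prop. 3.5, Rem. 3.6 [KimNakamura2020];
K. Rubin, *Euler Systems* (2000) Def. 4.4.1 [Rubin2000]; bookkeeping [folklore].
-/

noncomputable section

-- the Theorems namespace of a single-conjunct summit repeats the summit name by design (D-0017)
set_option linter.dupNamespace false

open scoped BigOperators TensorProduct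
open Finset
open Literature.NumberTheory.EllipticCurves.Kato2004.EulerSystemValues
open Summit.BirchSwinnertonDyer.Rank1Residual.GaloisImage
open Summit.BirchSwinnertonDyer.Rank1Residual.GaloisImage.GroupRingEval

namespace Summit.BirchSwinnertonDyer.BirchSwinnertonDyer.Theorems.KimAtThreeShallowEqDeepAnomalousGlue

variable (p : ℕ) [Fact p.Prime] (n : ℕ) [NeZero n]

/-! ### §1 Group-ring / tensor plumbing with an integral factor -/

/-- **Congruent elements of `ℤ_p[(ℤ/n)ˣ]` differ by `p^K • Z`** (integral form of E-B's congruence lemma: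
coefficientwise `ker (toZModPow K) = (p^K)`). [folklore] -/
theorem exists_eq_add_pow_smul_of_mapRingHom_eq (K : ℕ) (Θ Θ' : MonoidAlgebra ℤ_[p] (ZMod n)ˣ)
    (h : MonoidAlgebra.mapRingHom (ZMod n)ˣ (PadicInt.toZModPow K) Θ =
      MonoidAlgebra.mapRingHom (ZMod n)ˣ (PadicInt.toZModPow K) Θ') :
    ∃ Z : MonoidAlgebra ℤ_[p] (ZMod n)ˣ, Θ = Θ' + ((p : ℤ_[p]) ^ K) • Z := by
  classical
  have hcoef : ∀ g : (ZMod n)ˣ, ∃ w : ℤ_[p], w * (p : ℤ_[p]) ^ K = Θ.coeff g - Θ'.coeff g := by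
    intro g
    have hg := congrArg (fun X => MonoidAlgebra.coeff X g) h
    simp only [MonoidAlgebra.coeff_mapRingHom] at hg
    have hmem : Θ.coeff g - Θ'.coeff g ∈ RingHom.ker (PadicInt.toZModPow K) := by
      rw [RingHom.mem_ker, map_sub, hg, sub_self]
    rw [PadicInt.ker_toZModPow] at hmem
    exact Ideal.mem_span_singleton'.1 hmem
  choose w hw using hcoef
  refine ⟨∑ g : (ZMod n)ˣ, MonoidAlgebra.single g (w g), ?_⟩
  refine MonoidAlgebra.coeff_injective (Finsupp.ext fun g => ?_)
  rw [MonoidAlgebra.coeff_add, Finsupp.add_apply, MonoidAlgebra.coeff_smul_apply, MonoidAlgebra.coeff_sum,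
    Finset.sum_apply', Finset.sum_eq_single g (fun h _ hne => by
      rw [MonoidAlgebra.single, MonoidAlgebra.coeff_ofCoeff, Finsupp.single_eq_of_ne hne.symm])
      (fun hg => absurd (Finset.mem_univ g) hg)]
  rw [MonoidAlgebra.single, MonoidAlgebra.coeff_ofCoeff, Finsupp.single_eq_same, smul_eq_mul, mul_comm, hw g]
  ring

set_option backward.isDefEq.respectTransparency false in
/-- **`ev_p(P·Z) = Σ_g P_g • (1 ⊗ σ_g)(ev_p Z)`** for integral `P, Z` (E-B's multiplicativity
`sum_coeff_mul_tmul_sigma` along `ℤ_p ↪ ℚ_p`). [folklore] -/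
theorem sum_coeff_coe_mul_tmul_sigma (P Z : MonoidAlgebra ℤ_[p] (ZMod n)ˣ) (z : CyclotomicField n ℚ) :
    ∑ g : (ZMod n)ˣ, (((P * Z).coeff g : ℤ_[p]) : ℚ_[p]) ⊗ₜ[ℚ] sigma n g z =
      ∑ g : (ZMod n)ˣ, ((P.coeff g : ℤ_[p]) : ℚ_[p]) • Algebra.TensorProduct.map (AlgHom.id ℚ ℚ_[p])
        (sigma n g : CyclotomicField n ℚ →ₐ[ℚ] CyclotomicField n ℚ)
          (∑ h : (ZMod n)ˣ, ((Z.coeff h : ℤ_[p]) : ℚ_[p]) ⊗ₜ[ℚ] sigma n h z) := by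
  have h := sum_coeff_mul_tmul_sigma p n
    (MonoidAlgebra.mapRingHom (ZMod n)ˣ (PadicInt.Coe.ringHom (p := p)) P)
    (MonoidAlgebra.mapRingHom (ZMod n)ˣ (PadicInt.Coe.ringHom (p := p)) Z) z
  rw [← map_mul] at h
  simp_rw [MonoidAlgebra.coeff_mapRingHom] at h
  exact h

set_option backward.isDefEq.respectTransparency false in
/-- `(1 ⊗ σ_g)` commutes with `ℤ_p`-scalars on `ℚ_p ⊗_ℚ ℚ(ζ_n)`. [folklore] -/
theorem tensorSigma_smul (g : (ZMod n)ˣ) (r : ℤ_[p]) (v : ℚ_[p] ⊗[ℚ] CyclotomicField n ℚ) :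
    Algebra.TensorProduct.map (AlgHom.id ℚ ℚ_[p])
        (sigma n g : CyclotomicField n ℚ →ₐ[ℚ] CyclotomicField n ℚ) (r • v) =
      r • Algebra.TensorProduct.map (AlgHom.id ℚ ℚ_[p])
        (sigma n g : CyclotomicField n ℚ →ₐ[ℚ] CyclotomicField n ℚ) v := by
  induction v using TensorProduct.induction_on with
  | zero => rw [smul_zero, map_zero, smul_zero]
  | tmul a w =>
    rw [TensorProduct.smul_tmul', Algebra.TensorProduct.map_tmul, Algebra.TensorProduct.map_tmul,
      TensorProduct.smul_tmul']
    rfl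
  | add u w hu hw => rw [smul_add, map_add, map_add, hu, hw, smul_add]

set_option backward.isDefEq.respectTransparency false in
/-- **The twisted-lattice operator `l ↦ Σ_g P_g • (1 ⊗ σ_g) l` is `ℤ_p`-linear** (so a unit of `ℤ_p` moves
through it). [folklore] -/
theorem smul_sum_coeff_smul_tensorSigma (P : MonoidAlgebra ℤ_[p] (ZMod n)ˣ) (r : ℤ_[p])
    (v : ℚ_[p] ⊗[ℚ] CyclotomicField n ℚ) :
    r • ∑ g : (ZMod n)ˣ, ((P.coeff g : ℤ_[p]) : ℚ_[p]) • Algebra.TensorProduct.map (AlgHom.id ℚ ℚ_[p])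
        (sigma n g : CyclotomicField n ℚ →ₐ[ℚ] CyclotomicField n ℚ) v =
      ∑ g : (ZMod n)ˣ, ((P.coeff g : ℤ_[p]) : ℚ_[p]) • Algebra.TensorProduct.map (AlgHom.id ℚ ℚ_[p])
        (sigma n g : CyclotomicField n ℚ →ₐ[ℚ] CyclotomicField n ℚ) (r • v) := by
  rw [Finset.smul_sum]
  refine Finset.sum_congr rfl fun g _ => ?_
  rw [tensorSigma_smul, smul_comm]

/-- **`X · N_G` through the augmentation, integral form**: `P·V′·Σ_g δ_g = (aug V′ · aug P) • Σ_g δ_g`.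
[folklore] -/
theorem mul_mul_sum_single_one_eq_smul (P V : MonoidAlgebra ℤ_[p] (ZMod n)ˣ) :
    P * V * ∑ g : (ZMod n)ˣ, MonoidAlgebra.single g (1 : ℤ_[p]) =
      ((∑ g : (ZMod n)ˣ, V.coeff g) * ∑ g : (ZMod n)ˣ, P.coeff g) •
        ∑ g : (ZMod n)ˣ, MonoidAlgebra.single g (1 : ℤ_[p]) := by
  rw [mul_assoc, mul_sum_single_one_eq_sum_coeff_smul, mul_smul_comm, mul_sum_single_one_eq_sum_coeff_smul,
    smul_smul, mul_comm]

/-! ### §2 ★★ MAIN GLUE on the twisted lattice, comparison form -/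

set_option backward.isDefEq.respectTransparency false in
/-- **★★ MAIN GLUE ON THE TWISTED LATTICE (comparison form).**  Let `X ∈ ℚ[(ℤ/n)ˣ]` (the avatar — NOT
assumed integral), `Θ, P, V′, W ∈ ℤ_p[(ℤ/n)ˣ]`, units `b_i` with lengths `N_i`, and suppose
`X·∏D = (Θ·(P·V′)·∏D)^{ℚ_p} + p^K·(P·W)^{ℚ_p}` in `ℚ_p[(ℤ/n)ˣ]` (`hXY`: the seat's FACTORED congruence in E-C
currency), PK-3's identity `Θ̄·∏D = c·∏Nrm` (`hD`) and `∏Nrm = Σ_g δ_g` (`hnorm`).  Then for every lift `c̃`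
of `c`:
`∃ l ∈ L_int(n), 1 ⊗ 𝔇^{field}(Σ_g X_g • σ_g ζ_n) − ((c̃ · aug V′ · aug P) · μ(n)) ⊗ 1 = p^K • Σ_g P_g • (1 ⊗ σ_g) l`
— E-C's ★★ `exists_mem_cycIntLattice_one_tmul_deriv_sub_tmul_eq_pow_smul_of_comparison` with the factor `P`
carried to the LATTICE side instead of being read mod `p^K`.
[cite: Kim2022StructureSelmer, the proof of Thm. 3.13 (arXiv v3 pp. 26–28; = Thm. 3.11 of AJM 148)]
[cite: KimNakamura2020, Prop. 3.5 and Rem. 3.6 (arXiv v2 pp. 8–9)] -/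
theorem exists_mem_cycIntLattice_one_tmul_deriv_sub_tmul_eq_pow_smul_twist_of_comparison {ι : Type*}
    (d : Finset ι) (b : ι → (ZMod n)ˣ) (N : ι → ℕ) (X : MonoidAlgebra ℚ (ZMod n)ˣ)
    (Θ P V W : MonoidAlgebra ℤ_[p] (ZMod n)ˣ) (K : ℕ) (c : ZMod (p ^ K))
    (hXY : MonoidAlgebra.mapRingHom (ZMod n)ˣ (algebraMap ℚ ℚ_[p]) X *
        ∏ i ∈ d, ∑ j : Fin (N i), MonoidAlgebra.single (b i ^ (j : ℕ)) ((j : ℕ) : ℚ_[p]) =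
      MonoidAlgebra.mapRingHom (ZMod n)ˣ (PadicInt.Coe.ringHom (p := p))
          (Θ * (P * V) * ∏ i ∈ d, ∑ j : Fin (N i), MonoidAlgebra.single (b i ^ (j : ℕ)) ((j : ℕ) : ℤ_[p])) +
        ((p : ℚ_[p]) ^ K) • MonoidAlgebra.mapRingHom (ZMod n)ˣ (PadicInt.Coe.ringHom (p := p)) (P * W))
    (hD : MonoidAlgebra.mapRingHom (ZMod n)ˣ (PadicInt.toZModPow K) Θ *
        ∏ i ∈ d, ∑ j : Fin (N i), MonoidAlgebra.single (b i ^ (j : ℕ)) ((j : ℕ) : ZMod (p ^ K)) =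
      c • ∏ i ∈ d, ∑ j : Fin (N i), MonoidAlgebra.single (b i ^ (j : ℕ)) (1 : ZMod (p ^ K)))
    (hnorm : ∏ i ∈ d, ∑ j : Fin (N i), MonoidAlgebra.single (b i ^ (j : ℕ)) (1 : ℤ_[p]) =
      ∑ g : (ZMod n)ˣ, MonoidAlgebra.single g 1)
    (c' : ℤ_[p]) (hc : PadicInt.toZModPow K c' = c)
    (comm : (d : Set ι).Pairwise fun i i' => Commute
      (∑ j ∈ Finset.range (N i), (j : Module.End ℚ (CyclotomicField n ℚ)) *
        (sigma n (b i) : CyclotomicField n ℚ →ₐ[ℚ] CyclotomicField n ℚ).toLinearMap ^ j)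
      (∑ j ∈ Finset.range (N i'), (j : Module.End ℚ (CyclotomicField n ℚ)) *
        (sigma n (b i') : CyclotomicField n ℚ →ₐ[ℚ] CyclotomicField n ℚ).toLinearMap ^ j)) :
    ∃ l ∈ cycIntLattice p n,
      (1 : ℚ_[p]) ⊗ₜ[ℚ] (d.noncommProd (fun i => ∑ j ∈ Finset.range (N i),
        (j : Module.End ℚ (CyclotomicField n ℚ)) *
          (sigma n (b i) : CyclotomicField n ℚ →ₐ[ℚ] CyclotomicField n ℚ).toLinearMap ^ j) comm
        (∑ g : (ZMod n)ˣ, X.coeff g • sigma n g (IsCyclotomicExtension.zeta n ℚ (CyclotomicField n ℚ)))) -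
        (((c' * (∑ g : (ZMod n)ˣ, V.coeff g) * (∑ g : (ZMod n)ˣ, P.coeff g) : ℤ_[p]) : ℚ_[p]) *
          (ArithmeticFunction.moebius n : ℚ_[p])) ⊗ₜ[ℚ] (1 : CyclotomicField n ℚ) =
      ((p : ℤ_[p]) ^ K) • ∑ g : (ZMod n)ˣ, ((P.coeff g : ℤ_[p]) : ℚ_[p]) •
        Algebra.TensorProduct.map (AlgHom.id ℚ ℚ_[p])
          (sigma n g : CyclotomicField n ℚ →ₐ[ℚ] CyclotomicField n ℚ) l := by
  classical
  have commT := ZetaValue.pairwise_commute_tensorDeriv p n b N d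
  -- PK-3's identity, lifted: `Θ·∏D = c̃ • ∏Nrm + p^K • Z` in `ℤ_p[(ℤ/n)ˣ]`
  have hcong : MonoidAlgebra.mapRingHom (ZMod n)ˣ (PadicInt.toZModPow K)
      (Θ * ∏ i ∈ d, ∑ j : Fin (N i), MonoidAlgebra.single (b i ^ (j : ℕ)) ((j : ℕ) : ℤ_[p])) =
      MonoidAlgebra.mapRingHom (ZMod n)ˣ (PadicInt.toZModPow K)
        (c' • ∏ i ∈ d, ∑ j : Fin (N i), MonoidAlgebra.single (b i ^ (j : ℕ)) (1 : ℤ_[p])) := by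
    rw [map_mul, mapRingHom_prod_sum_single_pow, mapRingHom_smul, mapRingHom_prod_sum_single_pow, hc]
    simp_rw [map_natCast, map_one]
    exact hD
  obtain ⟨Z, hZ⟩ := exists_eq_add_pow_smul_of_mapRingHom_eq p n K _ _ hcong
  -- hence `Θ·(P·V)·∏D = (c̃ · aug V · aug P) • Σ_g δ_g + p^K • (P·(V·Z))`
  have hkey : Θ * (P * V) * ∏ i ∈ d, ∑ j : Fin (N i), MonoidAlgebra.single (b i ^ (j : ℕ)) ((j : ℕ) : ℤ_[p]) =
      (c' * (∑ g : (ZMod n)ˣ, V.coeff g) * (∑ g : (ZMod n)ˣ, P.coeff g)) •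
          ∑ g : (ZMod n)ˣ, MonoidAlgebra.single g (1 : ℤ_[p]) +
        ((p : ℤ_[p]) ^ K) • (P * (V * Z)) := by
    rw [mul_assoc Θ, mul_comm (P * V), ← mul_assoc, hZ, hnorm, add_mul, smul_mul_assoc, smul_mul_assoc,
      mul_comm (∑ g : (ZMod n)ˣ, MonoidAlgebra.single g (1 : ℤ_[p])) (P * V), mul_mul_sum_single_one_eq_smul,
      smul_smul, mul_assoc c']
    congr 1
    rw [mul_comm Z (P * V), mul_assoc]
  refine ⟨∑ g : (ZMod n)ˣ, (((V * Z + W).coeff g : ℤ_[p]) : ℚ_[p]) ⊗ₜ[ℚ]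
      sigma n g (IsCyclotomicExtension.zeta n ℚ (CyclotomicField n ℚ)),
    sum_coeff_tmul_sigma_zeta_mem_cycIntLattice p n _, ?_⟩
  -- `1 ⊗ 𝔇^{field}(ev X) = 𝔇^{tensor}(ev_p X) = ev_p(X·∏D) = ev_p((c̃ aug V aug P)•Σδ) + p^K • ev_p(P·(V·Z + W))`
  have hcoe : ∀ x : ℤ_[p], PadicInt.Coe.ringHom x = (x : ℚ_[p]) := fun _ => rfl
  rw [one_tmul_fieldDeriv_eq_tensorDeriv p n b N d comm commT, one_tmul_sum_coeff_smul_sigma,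
    ← sum_coeff_mul_prod_deriv_tmul_sigma p n d b N _ _ commT, hXY, hkey, map_add, mapRingHom_smul,
    mapRingHom_smul]
  simp only [hcoe, PadicInt.coe_pow, PadicInt.coe_natCast]
  rw [add_assoc, ← smul_add, ← map_add, ← mul_add]
  -- split the evaluation into the scalar part and the `p^K • P·(…)` part
  have hsplit : ∀ (A B : MonoidAlgebra ℚ_[p] (ZMod n)ˣ),
      ∑ g : (ZMod n)ˣ, ((A + B).coeff g) ⊗ₜ[ℚ] sigma n g (IsCyclotomicExtension.zeta n ℚ (CyclotomicField n ℚ)) =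
      ∑ g : (ZMod n)ˣ, (A.coeff g) ⊗ₜ[ℚ] sigma n g (IsCyclotomicExtension.zeta n ℚ (CyclotomicField n ℚ)) +
        ∑ g : (ZMod n)ˣ, (B.coeff g) ⊗ₜ[ℚ] sigma n g (IsCyclotomicExtension.zeta n ℚ (CyclotomicField n ℚ)) := by
    intro A B
    rw [← Finset.sum_add_distrib]
    refine Finset.sum_congr rfl fun g _ => ?_
    rw [MonoidAlgebra.coeff_add, Finsupp.add_apply, TensorProduct.add_tmul]
  -- the scalar part: `ev_p((c̃ aug V aug P) • Σδ) = ((c̃ aug V aug P)·μ(n)) ⊗ 1`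
  have hA : ∑ g : (ZMod n)ˣ, ((((c' * (∑ g : (ZMod n)ˣ, V.coeff g) * (∑ g : (ZMod n)ˣ, P.coeff g) : ℤ_[p]) :
          ℚ_[p]) • MonoidAlgebra.mapRingHom (ZMod n)ˣ (PadicInt.Coe.ringHom (p := p))
          (∑ g : (ZMod n)ˣ, MonoidAlgebra.single g (1 : ℤ_[p]))).coeff g) ⊗ₜ[ℚ]
        sigma n g (IsCyclotomicExtension.zeta n ℚ (CyclotomicField n ℚ)) =
      (((c' * (∑ g : (ZMod n)ˣ, V.coeff g) * (∑ g : (ZMod n)ˣ, P.coeff g) : ℤ_[p]) : ℚ_[p]) *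
        (ArithmeticFunction.moebius n : ℚ_[p])) ⊗ₜ[ℚ] (1 : CyclotomicField n ℚ) := by
    rw [← sum_tmul_sigma_zeta_smul_sum_single p n]
    refine Finset.sum_congr rfl fun g _ => ?_
    simp only [MonoidAlgebra.coeff_smul_apply, MonoidAlgebra.coeff_mapRingHom, hcoe, smul_eq_mul,
      PadicInt.coe_mul]
  -- the `p^K • P·Y` part: `ev_p(p^K • (P·Y)^{ℚ_p}) = p^K • Σ_g P_g • (1 ⊗ σ_g)(ev_p Y)`
  have hB : ∀ Y : MonoidAlgebra ℤ_[p] (ZMod n)ˣ,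
      ∑ g : (ZMod n)ˣ, ((((p : ℚ_[p]) ^ K) • MonoidAlgebra.mapRingHom (ZMod n)ˣ (PadicInt.Coe.ringHom (p := p))
          (P * Y)).coeff g) ⊗ₜ[ℚ] sigma n g (IsCyclotomicExtension.zeta n ℚ (CyclotomicField n ℚ)) =
      ((p : ℤ_[p]) ^ K) • ∑ g : (ZMod n)ˣ, ((P.coeff g : ℤ_[p]) : ℚ_[p]) •
        Algebra.TensorProduct.map (AlgHom.id ℚ ℚ_[p])
          (sigma n g : CyclotomicField n ℚ →ₐ[ℚ] CyclotomicField n ℚ)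
            (∑ h : (ZMod n)ˣ, ((Y.coeff h : ℤ_[p]) : ℚ_[p]) ⊗ₜ[ℚ]
              sigma n h (IsCyclotomicExtension.zeta n ℚ (CyclotomicField n ℚ))) := by
    intro Y
    rw [← sum_coeff_coe_mul_tmul_sigma, Finset.smul_sum]
    refine Finset.sum_congr rfl fun g _ => ?_
    simp only [MonoidAlgebra.coeff_smul_apply, MonoidAlgebra.coeff_mapRingHom, hcoe, smul_eq_mul]
    rw [TensorProduct.smul_tmul', Algebra.smul_def, map_pow, map_natCast]
  rw [hsplit, hA, hB]
  -- the lattice element `ev_p(V·Z + W)`; rearrange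
  abel

/-! ### §3 ★★ The symmetrised-avatar form (PK-4b-C's scalar `λ = n`, the rider's `p • Λ`) -/

set_option backward.isDefEq.respectTransparency false in
/-- **★★ THE VALUE WITNESS ON THE TWISTED LATTICE.**  §2 for the symmetrised avatar `X⁺ = (p·λ)•(1 + δ₋₁)X`
of `x` (`hxX`, T-PKEV E-D) with `λ` a rational `p`-adic unit (`u`, `hu`; PK-4b-C's `λ = n`): dividing by `u`
but KEEPING the factor `p`,
`∃ l ∈ L_int(n), (p : ℤ_p) • (1 ⊗ 𝔇^{field}(x + σ₋₁ x)) − (u⁻¹ · c̃ · μ(n) · aug V′ · aug P) ⊗ 1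
  = p^K • Σ_g P_g • (1 ⊗ σ_g) l`
— TOKEN-FOR-TOKEN the premise of the anomalous rider's scalar clause at `y⁺ = D·z + g₋·D·z`
(`p • Λ_{0,r}(y⁺) = p • (1 ⊗ 𝔇^{field}(x_{0,r} + σ₋₁ x_{0,r}))` by PK-1 ★2 / (C3a)), with the scalar
`s · aug P`, `s = u⁻¹ c̃ μ(n) aug V′`.
[cite: Kim2022StructureSelmer, the proof of Thm. 3.13 (arXiv v3 pp. 26–28; = Thm. 3.11 of AJM 148)]
[cite: KimNakamura2020, Prop. 3.5 and Rem. 3.6 (arXiv v2 pp. 8–9)] -/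
theorem exists_mem_cycIntLattice_symm_deriv_sub_tmul_eq_pow_smul_twist_of_comparison {ι : Type*}
    (d : Finset ι) (b : ι → (ZMod n)ˣ) (N : ι → ℕ)
    (x : CyclotomicField n ℚ) (X : MonoidAlgebra ℚ (ZMod n)ˣ)
    (hxX : x = ∑ g : (ZMod n)ˣ, X.coeff g • sigma n g (IsCyclotomicExtension.zeta n ℚ (CyclotomicField n ℚ)))
    (c₀ : ℚ) (u : ℤ_[p]ˣ) (hu : ((u : ℤ_[p]) : ℚ_[p]) = (c₀ : ℚ_[p]))
    (Θ P V W : MonoidAlgebra ℤ_[p] (ZMod n)ˣ) (K : ℕ) (c : ZMod (p ^ K))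
    (hXY : MonoidAlgebra.mapRingHom (ZMod n)ˣ (algebraMap ℚ ℚ_[p])
          (((p : ℚ) * c₀) • ((1 + MonoidAlgebra.single (-1 : (ZMod n)ˣ) (1 : ℚ)) * X)) *
        ∏ i ∈ d, ∑ j : Fin (N i), MonoidAlgebra.single (b i ^ (j : ℕ)) ((j : ℕ) : ℚ_[p]) =
      MonoidAlgebra.mapRingHom (ZMod n)ˣ (PadicInt.Coe.ringHom (p := p))
          (Θ * (P * V) * ∏ i ∈ d, ∑ j : Fin (N i), MonoidAlgebra.single (b i ^ (j : ℕ)) ((j : ℕ) : ℤ_[p])) +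
        ((p : ℚ_[p]) ^ K) • MonoidAlgebra.mapRingHom (ZMod n)ˣ (PadicInt.Coe.ringHom (p := p)) (P * W))
    (hD : MonoidAlgebra.mapRingHom (ZMod n)ˣ (PadicInt.toZModPow K) Θ *
        ∏ i ∈ d, ∑ j : Fin (N i), MonoidAlgebra.single (b i ^ (j : ℕ)) ((j : ℕ) : ZMod (p ^ K)) =
      c • ∏ i ∈ d, ∑ j : Fin (N i), MonoidAlgebra.single (b i ^ (j : ℕ)) (1 : ZMod (p ^ K)))
    (hnorm : ∏ i ∈ d, ∑ j : Fin (N i), MonoidAlgebra.single (b i ^ (j : ℕ)) (1 : ℤ_[p]) =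
      ∑ g : (ZMod n)ˣ, MonoidAlgebra.single g 1)
    (c' : ℤ_[p]) (hc : PadicInt.toZModPow K c' = c)
    (comm : (d : Set ι).Pairwise fun i i' => Commute
      (∑ j ∈ Finset.range (N i), (j : Module.End ℚ (CyclotomicField n ℚ)) *
        (sigma n (b i) : CyclotomicField n ℚ →ₐ[ℚ] CyclotomicField n ℚ).toLinearMap ^ j)
      (∑ j ∈ Finset.range (N i'), (j : Module.End ℚ (CyclotomicField n ℚ)) *
        (sigma n (b i') : CyclotomicField n ℚ →ₐ[ℚ] CyclotomicField n ℚ).toLinearMap ^ j)) :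
    ∃ l ∈ cycIntLattice p n,
      (p : ℤ_[p]) • ((1 : ℚ_[p]) ⊗ₜ[ℚ] (d.noncommProd (fun i => ∑ j ∈ Finset.range (N i),
          (j : Module.End ℚ (CyclotomicField n ℚ)) *
            (sigma n (b i) : CyclotomicField n ℚ →ₐ[ℚ] CyclotomicField n ℚ).toLinearMap ^ j) comm
          (x + sigma n (-1) x))) -
        (((↑u⁻¹ : ℤ_[p]) * c' * ((ArithmeticFunction.moebius n : ℤ) : ℤ_[p]) *
            (∑ g : (ZMod n)ˣ, V.coeff g) * (∑ g : (ZMod n)ˣ, P.coeff g) : ℤ_[p]) : ℚ_[p]) ⊗ₜ[ℚ]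
          (1 : CyclotomicField n ℚ) =
      ((p : ℤ_[p]) ^ K) • ∑ g : (ZMod n)ˣ, ((P.coeff g : ℤ_[p]) : ℚ_[p]) •
        Algebra.TensorProduct.map (AlgHom.id ℚ ℚ_[p])
          (sigma n g : CyclotomicField n ℚ →ₐ[ℚ] CyclotomicField n ℚ) l := by
  obtain ⟨l₁, hl₁, h₁⟩ :=
    exists_mem_cycIntLattice_one_tmul_deriv_sub_tmul_eq_pow_smul_twist_of_comparison p n d b N
      (((p : ℚ) * c₀) • ((1 + MonoidAlgebra.single (-1 : (ZMod n)ˣ) (1 : ℚ)) * X)) Θ P V W K c hXY hD hnorm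
      c' hc comm
  -- the argument of `𝔇^{field}` is `(p·λ) • (x + σ₋₁ x)`; pull the scalar out as `((p : ℤ_p) · u : ℚ_p) ⊗ …`
  rw [sum_coeff_smul_symm_smul_sigma_zeta n x X hxX ((p : ℚ) * c₀), map_smul, ← TensorProduct.smul_tmul,
    Rat.smul_one_eq_cast, Rat.cast_mul, Rat.cast_natCast, ← hu] at h₁
  -- multiply by the `p`-adic unit `u⁻¹`
  refine ⟨(↑u⁻¹ : ℤ_[p]) • l₁, Submodule.smul_mem _ _ hl₁, ?_⟩
  rw [← smul_sum_coeff_smul_tensorSigma, smul_comm, ← h₁, smul_sub, padicInt_smul_tmul, padicInt_smul_tmul,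
    padicInt_smul_tmul]
  have e1 : ((↑u⁻¹ : ℤ_[p]) : ℚ_[p]) * ((p : ℚ_[p]) * ((u : ℤ_[p]) : ℚ_[p])) = (((p : ℤ_[p]) : ℤ_[p]) : ℚ_[p]) * 1 := by
    rw [mul_one, mul_left_comm, ← PadicInt.coe_mul, Units.inv_mul, PadicInt.coe_one, mul_one, PadicInt.coe_natCast]
  have e2 : ((↑u⁻¹ : ℤ_[p]) : ℚ_[p]) *
      (((c' * (∑ g : (ZMod n)ˣ, V.coeff g) * (∑ g : (ZMod n)ˣ, P.coeff g) : ℤ_[p]) : ℚ_[p]) *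
        (ArithmeticFunction.moebius n : ℚ_[p])) =
      (((↑u⁻¹ : ℤ_[p]) * c' * ((ArithmeticFunction.moebius n : ℤ) : ℤ_[p]) *
          (∑ g : (ZMod n)ˣ, V.coeff g) * (∑ g : (ZMod n)ˣ, P.coeff g) : ℤ_[p]) : ℚ_[p]) := by
    push_cast
    ring
  rw [e1, e2]

end Summit.BirchSwinnertonDyer.BirchSwinnertonDyer.Theorems.KimAtThreeShallowEqDeepAnomalousGlue

end
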